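import Mathlib

/-!
# PercRepro — an `e`-free partition is two flats avoiding `e` that cover `E ∖ {e}` (night-1, gen 3)

`proofs/NIGHT-1-C025-induction.md` §14.13. The core of the `|E|`-induction wrappers (`rls_succ_all`, `rls_succ_large`)
is «every element `e` admits an `e`-free partition of `E ∖ {e}`: two complementary sides, neither spanning `e`».
Equivalently — with no reference to partitions — **`E ∖ {e}` is covered by two flats not containing `e`**
(`free_partition_iff_two_flats`); equivalently by two hyperplanes not containing `e`, i.e. `e` lies in two cocircuits
whose intersection is exactly `{e}` (the hyperplane form is the flat form with the flats enlarged to hyperplanes). A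
loop lies in every flat, a coloop in no flat avoiding it... (a coloop `e` has `E ∖ {e}` itself as a flat avoiding `e`, so
coloops always qualify, as used in `rls_succ_large`). Mathlib only. Axioms: standard.
-/

namespace PercRepro

namespace ThmN

variable {α : Type} {M : Matroid α}

/-- **The `e`-free partition condition in flat form**: `E ∖ {e}` splits into two sides neither of which spans `e` iff
`E ∖ {e}` is covered by two flats of `M` not containing `e`. -/
theorem free_partition_iff_two_flats {e : α} :
    (∃ A ⊆ M.E \ {e}, e ∉ M.closure A ∧ e ∉ M.closure ((M.E \ {e}) \ A)) ↔
      ∃ F₁ F₂ : Set α, M.IsFlat F₁ ∧ M.IsFlat F₂ ∧ e ∉ F₁ ∧ e ∉ F₂ ∧ M.E \ {e} ⊆ F₁ ∪ F₂ := by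
  constructor
  · rintro ⟨A, hA, heA, heB⟩
    refine ⟨M.closure A, M.closure ((M.E \ {e}) \ A), M.isFlat_closure A, M.isFlat_closure _, heA, heB, ?_⟩
    intro x hx
    by_cases hxA : x ∈ A
    · exact Or.inl (M.subset_closure A (hA.trans Set.sdiff_subset) hxA)
    · exact Or.inr (M.subset_closure _ (Set.sdiff_subset.trans Set.sdiff_subset) ⟨hx, hxA⟩)
  · rintro ⟨F₁, F₂, hF₁, hF₂, heF₁, heF₂, hcov⟩
    refine ⟨F₁ ∩ (M.E \ {e}), Set.inter_subset_right, ?_, ?_⟩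
    · intro h
      have : M.closure (F₁ ∩ (M.E \ {e})) ⊆ F₁ := by
        calc M.closure (F₁ ∩ (M.E \ {e})) ⊆ M.closure F₁ := M.closure_subset_closure Set.inter_subset_left
          _ = F₁ := hF₁.closure
      exact heF₁ (this h)
    · intro h
      have hsub : (M.E \ {e}) \ (F₁ ∩ (M.E \ {e})) ⊆ F₂ := by
        intro x hx
        rcases hcov hx.1 with h₁ | h₂
        · exact absurd ⟨h₁, hx.1⟩ hx.2
        · exact h₂
      have : M.closure ((M.E \ {e}) \ (F₁ ∩ (M.E \ {e}))) ⊆ F₂ := by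
        calc M.closure ((M.E \ {e}) \ (F₁ ∩ (M.E \ {e}))) ⊆ M.closure F₂ := M.closure_subset_closure hsub
          _ = F₂ := hF₂.closure
      exact heF₂ (this h)

/-- A coloop always admits an `e`-free partition: `E ∖ {e}` is a flat avoiding `e` (take both flats equal to it). -/
theorem free_partition_of_isColoop {e : α} (he : M.IsColoop e) :
    ∃ A ⊆ M.E \ {e}, e ∉ M.closure A ∧ e ∉ M.closure ((M.E \ {e}) \ A) := by
  refine ⟨M.E \ {e}, le_rfl, ?_, ?_⟩
  · exact (Matroid.isColoop_iff_notMem_closure_compl he.mem_ground).1 he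
  · rw [Set.sdiff_self]
    intro h
    exact (Matroid.isColoop_iff_notMem_closure_compl he.mem_ground).1 he
      (M.closure_subset_closure (Set.empty_subset _) h)

end ThmN

end PercRepro
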